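import Summits.ResolutionOfSingularities.ResolutionOfSingularities.Theorems.FrobeniusClosingPatchingRelPerfectDepthPhaseCMonomialTailLaws
import HarnessLib

/-!
# Crux `PatchingRelPerfect` (stmt-ResolutionOfSingularities-16161), chain W5.2 — F7(β) (β-AX) X3 C-II: the ONE-HOST TAIL GAME and its
# potential `Ψ = (n*, c*, Σ⁺)` — idea-1's `PsiDescent` and `TB2MoveExists` PROVED

[OURS · L1 W5.2 · F7(β) (β-AX) X3 `PhaseCTermination₂` C-II (tail lemma) · STATEMENTS = res-L1-w52-idea-1 g12 `Sketch-L1-idea-1-v12.lean` §1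
(X3 MEASURE MEMO inst. 2 §14) VERBATIM, credited; PROOFS = res-L1-w52-stub-1 g5 (idea-1: «mine to state, yours/lead-1's to prove»)].  Replaces
the role of NO printed item; NOT a statement of the manuscript under review (AI-written, weaker than expert review).

At a carrier point `x` of the pure-member tail class with ONE non-carrier host the residual ideal on the carrier is `K♭ = (U·q^γ, q^a)`; in the
residual currency (RULING G11-25 A8) the state is the integer vector `v := γ − a : Fin 3 → ℤ`.  `K♭` is a unit iff `v` is one-signed
(`IsVacated`).  An S1♯ line move blows up `W = V(q_c, q_d)` with `v c > 0 > v d`; TB2 says `d` is a heaviest negative letter (`IsTB2Move`).  In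
the `c`-chart the exceptional letter takes the slot of `c` with value `v c + v d` (`chartC`), in the `d`-chart the slot of `d` (`chartD`);
the other points of the exceptional fibre are the same tables with the strict-transform letter dropped (`dropLetter`).  `Ψ v = (n*, c*, Σ⁺)`
(`psi`), compared lexicographically (`PsiLT`).

* **`psiDescent : PsiDescent`** — every TB2-compliant line move strictly lowers `Ψ` at every point of the exceptional fibre (both chart
  origins, both generic points).  Proof: the six ordered pairs `(c, d)` by `fin_cases`, each conclusion by `split_ifs` + `omega` on the
  three coordinates (chart `c`: `(n*, c*)` kept, `Σ⁺` drops; chart `d` and the dropped-letter tables: `c*` drops when another letter sits at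
  level `n*`, otherwise `n*` drops).
* **`tb2MoveExists : TB2MoveExists`** — a non-vacated table admits a TB2 move (a positive letter exists, and a most negative one).
* `noTB2_cycle` — the two-move VALUE CYCLE without TB2 (idea-1 memo §14.4, tri-2 v11.5 X1), by `decide`.

So the one-host strict tail terminates under S1♯ (well-founded lexicographic descent of `Ψ`), which is idea-1's (F2); the multi-host case is
kit job j284586 / instalment 2.  Fact-free.

## References
* J. Kollár, *Lectures on Resolution of Singularities* (2007), (3.111) Step 3 (the monomial game behind the tail). [Kollar2007]
-/

-- `Summit.<Summit>.<Sub>.Theorems` with `Sub = Summit` (single-conjunct summit, D-0017)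
set_option linter.dupNamespace false

namespace Summit.ResolutionOfSingularities.ResolutionOfSingularities.Theorems.X3Tail

/-! ## §1 The one-host tail game on `Fin 3 → ℤ` (idea-1 Sketch v12 §1, verbatim) -/

/-- [OURS · idea-1 Sketch v12] `K♭` is a unit at the point: the residual table is one-signed. -/
abbrev IsVacated (v : Fin 3 → ℤ) : Prop := (∀ ℓ, v ℓ ≤ 0) ∨ (∀ ℓ, 0 ≤ v ℓ)

/-- [OURS · idea-1 Sketch v12] A TB2-compliant S1♯ line move: `c` a positive (host-surplus) letter, `d` a negative (`N̄`-surplus) letter of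
MAXIMAL surplus. -/
abbrev IsTB2Move (v : Fin 3 → ℤ) (c d : Fin 3) : Prop :=
  c ≠ d ∧ 0 < v c ∧ v d < 0 ∧ ∀ ℓ, v ℓ < 0 → v d ≤ v ℓ

/-- [OURS · idea-1 Sketch v12] An S1 line move without the TB2 clause (used only to exhibit the cycle). -/
abbrev IsLineMove (v : Fin 3 → ℤ) (c d : Fin 3) : Prop := c ≠ d ∧ 0 < v c ∧ v d < 0

/-- [OURS · idea-1 Sketch v12] `c`-chart: the exceptional letter replaces `c` and carries `v c + v d`. -/
abbrev chartC (v : Fin 3 → ℤ) (c d : Fin 3) : Fin 3 → ℤ := Function.update v c (v c + v d)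

/-- [OURS · idea-1 Sketch v12] `d`-chart: the exceptional letter replaces `d` and carries `v c + v d`. -/
abbrev chartD (v : Fin 3 → ℤ) (c d : Fin 3) : Fin 3 → ℤ := Function.update v d (v c + v d)

/-- [OURS · idea-1 Sketch v12] A point of the exceptional fibre other than the chart origin: the strict-transform letter `ℓ` no longer
passes. -/
abbrev dropLetter (v : Fin 3 → ℤ) (ℓ : Fin 3) : Fin 3 → ℤ := Function.update v ℓ 0

/-- [OURS · idea-1 Sketch v12] `n*`: the largest `N̄`-surplus. -/
abbrev negMax (v : Fin 3 → ℤ) : ℕ := max (max (-v 0).toNat (-v 1).toNat) (-v 2).toNat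

/-- [OURS · idea-1 Sketch v12] `c*`: how many letters carry the largest `N̄`-surplus (0 if there is no negative letter). -/
abbrev negMaxCount (v : Fin 3 → ℤ) : ℕ :=
  (if v 0 < 0 ∧ (-v 0).toNat = negMax v then 1 else 0) + (if v 1 < 0 ∧ (-v 1).toNat = negMax v then 1 else 0) +
    (if v 2 < 0 ∧ (-v 2).toNat = negMax v then 1 else 0)

/-- [OURS · idea-1 Sketch v12] `Σ⁺`: total host surplus. -/
abbrev posSum (v : Fin 3 → ℤ) : ℕ := (v 0).toNat + (v 1).toNat + (v 2).toNat

/-- [OURS · idea-1 Sketch v12] `Ψ = (n*, c*, Σ⁺)`. -/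
abbrev psi (v : Fin 3 → ℤ) : ℕ × ℕ × ℕ := (negMax v, negMaxCount v, posSum v)

/-- [OURS · idea-1 Sketch v12] Lexicographic comparison of `Ψ`-values. -/
abbrev PsiLT (p q : ℕ × ℕ × ℕ) : Prop :=
  p.1 < q.1 ∨ (p.1 = q.1 ∧ (p.2.1 < q.2.1 ∨ (p.2.1 = q.2.1 ∧ p.2.2 < q.2.2)))

/-- [OURS · idea-1 Sketch v12 / X3 memo inst. 2 §14.3] **ONE-HOST TAIL LEMMA (statement).** Every TB2-compliant line move strictly lowers
`Ψ` at every point of the exceptional fibre over the point (both chart origins and the generic points of both charts). -/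
def PsiDescent : Prop :=
  ∀ (v : Fin 3 → ℤ) (c d : Fin 3), IsTB2Move v c d →
    PsiLT (psi (chartC v c d)) (psi v) ∧ PsiLT (psi (chartD v c d)) (psi v) ∧
      PsiLT (psi (dropLetter (chartC v c d) d)) (psi v) ∧ PsiLT (psi (dropLetter (chartD v c d) c)) (psi v)

/-- [OURS · idea-1 Sketch v12] A non-vacated table admits a TB2 move (so `PsiDescent` drives every S1♯ tail run to a unit residual). -/
def TB2MoveExists : Prop := ∀ v : Fin 3 → ℤ, ¬ IsVacated v → ∃ c d, IsTB2Move v c d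

/-! ## §2 The proofs -/

set_option maxHeartbeats 400000 in
-- six ordered pairs × four tables × `split_ifs`/`omega`
/-- Case `(c, d) = (0, 1)` of `psiDescent`. [folklore] -/
theorem psiDescent_01 (v : Fin 3 → ℤ) (hc : 0 < v 0) (hd : v 1 < 0) (_m0 : v 0 < 0 → v 1 ≤ v 0)
    (_m1 : v 1 < 0 → v 1 ≤ v 1) (_m2 : v 2 < 0 → v 1 ≤ v 2) :
    PsiLT (psi (chartC v 0 1)) (psi v) ∧ PsiLT (psi (chartD v 0 1)) (psi v) ∧
      PsiLT (psi (dropLetter (chartC v 0 1) 1)) (psi v) ∧ PsiLT (psi (dropLetter (chartD v 0 1) 0)) (psi v) := by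
  refine ⟨?_, ?_, ?_, ?_⟩ <;>
  · simp (config := { decide := true }) only [PsiLT, negMax, negMaxCount, posSum, chartC, chartD, dropLetter,
      Function.update_apply]
    split_ifs <;> omega

set_option maxHeartbeats 400000 in
-- six ordered pairs × four tables × `split_ifs`/`omega`
/-- Case `(c, d) = (0, 2)` of `psiDescent`. [folklore] -/
theorem psiDescent_02 (v : Fin 3 → ℤ) (hc : 0 < v 0) (hd : v 2 < 0) (_m0 : v 0 < 0 → v 2 ≤ v 0)
    (_m1 : v 1 < 0 → v 2 ≤ v 1) (_m2 : v 2 < 0 → v 2 ≤ v 2) :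
    PsiLT (psi (chartC v 0 2)) (psi v) ∧ PsiLT (psi (chartD v 0 2)) (psi v) ∧
      PsiLT (psi (dropLetter (chartC v 0 2) 2)) (psi v) ∧ PsiLT (psi (dropLetter (chartD v 0 2) 0)) (psi v) := by
  refine ⟨?_, ?_, ?_, ?_⟩ <;>
  · simp (config := { decide := true }) only [PsiLT, negMax, negMaxCount, posSum, chartC, chartD, dropLetter,
      Function.update_apply]
    split_ifs <;> omega

set_option maxHeartbeats 400000 in
-- six ordered pairs × four tables × `split_ifs`/`omega`
/-- Case `(c, d) = (1, 0)` of `psiDescent`. [folklore] -/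
theorem psiDescent_10 (v : Fin 3 → ℤ) (hc : 0 < v 1) (hd : v 0 < 0) (_m0 : v 0 < 0 → v 0 ≤ v 0)
    (_m1 : v 1 < 0 → v 0 ≤ v 1) (_m2 : v 2 < 0 → v 0 ≤ v 2) :
    PsiLT (psi (chartC v 1 0)) (psi v) ∧ PsiLT (psi (chartD v 1 0)) (psi v) ∧
      PsiLT (psi (dropLetter (chartC v 1 0) 0)) (psi v) ∧ PsiLT (psi (dropLetter (chartD v 1 0) 1)) (psi v) := by
  refine ⟨?_, ?_, ?_, ?_⟩ <;>
  · simp (config := { decide := true }) only [PsiLT, negMax, negMaxCount, posSum, chartC, chartD, dropLetter,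
      Function.update_apply]
    split_ifs <;> omega

set_option maxHeartbeats 400000 in
-- six ordered pairs × four tables × `split_ifs`/`omega`
/-- Case `(c, d) = (1, 2)` of `psiDescent`. [folklore] -/
theorem psiDescent_12 (v : Fin 3 → ℤ) (hc : 0 < v 1) (hd : v 2 < 0) (_m0 : v 0 < 0 → v 2 ≤ v 0)
    (_m1 : v 1 < 0 → v 2 ≤ v 1) (_m2 : v 2 < 0 → v 2 ≤ v 2) :
    PsiLT (psi (chartC v 1 2)) (psi v) ∧ PsiLT (psi (chartD v 1 2)) (psi v) ∧
      PsiLT (psi (dropLetter (chartC v 1 2) 2)) (psi v) ∧ PsiLT (psi (dropLetter (chartD v 1 2) 1)) (psi v) := by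
  refine ⟨?_, ?_, ?_, ?_⟩ <;>
  · simp (config := { decide := true }) only [PsiLT, negMax, negMaxCount, posSum, chartC, chartD, dropLetter,
      Function.update_apply]
    split_ifs <;> omega

set_option maxHeartbeats 400000 in
-- six ordered pairs × four tables × `split_ifs`/`omega`
/-- Case `(c, d) = (2, 0)` of `psiDescent`. [folklore] -/
theorem psiDescent_20 (v : Fin 3 → ℤ) (hc : 0 < v 2) (hd : v 0 < 0) (_m0 : v 0 < 0 → v 0 ≤ v 0)
    (_m1 : v 1 < 0 → v 0 ≤ v 1) (_m2 : v 2 < 0 → v 0 ≤ v 2) :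
    PsiLT (psi (chartC v 2 0)) (psi v) ∧ PsiLT (psi (chartD v 2 0)) (psi v) ∧
      PsiLT (psi (dropLetter (chartC v 2 0) 0)) (psi v) ∧ PsiLT (psi (dropLetter (chartD v 2 0) 2)) (psi v) := by
  refine ⟨?_, ?_, ?_, ?_⟩ <;>
  · simp (config := { decide := true }) only [PsiLT, negMax, negMaxCount, posSum, chartC, chartD, dropLetter,
      Function.update_apply]
    split_ifs <;> omega

set_option maxHeartbeats 400000 in
-- six ordered pairs × four tables × `split_ifs`/`omega`
/-- Case `(c, d) = (2, 1)` of `psiDescent`. [folklore] -/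
theorem psiDescent_21 (v : Fin 3 → ℤ) (hc : 0 < v 2) (hd : v 1 < 0) (_m0 : v 0 < 0 → v 1 ≤ v 0)
    (_m1 : v 1 < 0 → v 1 ≤ v 1) (_m2 : v 2 < 0 → v 1 ≤ v 2) :
    PsiLT (psi (chartC v 2 1)) (psi v) ∧ PsiLT (psi (chartD v 2 1)) (psi v) ∧
      PsiLT (psi (dropLetter (chartC v 2 1) 1)) (psi v) ∧ PsiLT (psi (dropLetter (chartD v 2 1) 2)) (psi v) := by
  refine ⟨?_, ?_, ?_, ?_⟩ <;>
  · simp (config := { decide := true }) only [PsiLT, negMax, negMaxCount, posSum, chartC, chartD, dropLetter,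
      Function.update_apply]
    split_ifs <;> omega

/-- **The one-host tail lemma holds** (idea-1 (F2)): dispatch on the ordered pair `(c, d)`. [cite: Kollar2007, (3.111) Step 3] -/
theorem psiDescent : PsiDescent := by
  intro v c d h
  obtain ⟨hcd, hc, hd, hmax⟩ := h
  have hc3 : c = 0 ∨ c = 1 ∨ c = 2 := by fin_cases c <;> simp
  have hd3 : d = 0 ∨ d = 1 ∨ d = 2 := by fin_cases d <;> simp
  rcases hc3 with rfl | rfl | rfl <;> rcases hd3 with rfl | rfl | rfl
  · exact absurd rfl hcd
  · exact psiDescent_01 v hc hd (hmax 0) (hmax 1) (hmax 2)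
  · exact psiDescent_02 v hc hd (hmax 0) (hmax 1) (hmax 2)
  · exact psiDescent_10 v hc hd (hmax 0) (hmax 1) (hmax 2)
  · exact absurd rfl hcd
  · exact psiDescent_12 v hc hd (hmax 0) (hmax 1) (hmax 2)
  · exact psiDescent_20 v hc hd (hmax 0) (hmax 1) (hmax 2)
  · exact psiDescent_21 v hc hd (hmax 0) (hmax 1) (hmax 2)
  · exact absurd rfl hcd

/-- **A non-vacated table admits a TB2 move.** [folklore] -/
theorem tb2MoveExists : TB2MoveExists := by
  intro v hv
  simp only [IsVacated, not_or, not_forall, not_le] at hv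
  obtain ⟨⟨i, hi⟩, ⟨j, hj⟩⟩ := hv
  have hj3 : j = 0 ∨ j = 1 ∨ j = 2 := by fin_cases j <;> simp
  -- a most negative letter exists
  have hneg : ∃ d : Fin 3, v d < 0 ∧ ∀ ℓ, v ℓ < 0 → v d ≤ v ℓ := by
    have key : ∀ d : Fin 3, v d < 0 → v d ≤ v 0 → v d ≤ v 1 → v d ≤ v 2 → ∃ d : Fin 3, v d < 0 ∧ ∀ ℓ, v ℓ < 0 → v d ≤ v ℓ := by
      intro d hd h0 h1 h2
      refine ⟨d, hd, fun ℓ _ => ?_⟩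
      have hℓ3 : ℓ = 0 ∨ ℓ = 1 ∨ ℓ = 2 := by fin_cases ℓ <;> simp
      rcases hℓ3 with rfl | rfl | rfl
      · exact h0
      · exact h1
      · exact h2
    by_cases h01 : v 0 ≤ v 1
    · by_cases h02 : v 0 ≤ v 2
      · exact key 0 (by rcases hj3 with rfl | rfl | rfl <;> omega) le_rfl h01 h02
      · exact key 2 (by rcases hj3 with rfl | rfl | rfl <;> omega) (by omega) (by omega) le_rfl
    · by_cases h12 : v 1 ≤ v 2
      · exact key 1 (by rcases hj3 with rfl | rfl | rfl <;> omega) (by omega) le_rfl h12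
      · exact key 2 (by rcases hj3 with rfl | rfl | rfl <;> omega) (by omega) (by omega) le_rfl
  obtain ⟨d, hd, hdmax⟩ := hneg
  refine ⟨i, d, ?_, hi, hd, hdmax⟩
  rintro rfl
  omega

/-! ## §3 Instances and the cycle without TB2 (idea-1 Sketch v12, verbatim) -/

/-- Toy instance (W2 after its first move, `t`-chart, memo §14.2: `K♭ = (y′², z)` in letters `(t, y′, z)`): `v = (0, 2, -1)`. -/
example : IsTB2Move ![0, 2, -1] 1 2 := by decide

example : PsiLT (psi (chartC ![0, 2, -1] 1 2)) (psi ![0, 2, -1]) ∧ PsiLT (psi (chartD ![0, 2, -1] 1 2)) (psi ![0, 2, -1]) := by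
  decide

/-- The two-exponent descent family `D(a,b)` of res-L1-w52-stub-2 (p549553): `v = (a, b, -1)`, `Ψ = (1, 1, a + b)`; one instance.
[folklore] -/
example : psi ![3, 2, -1] = (1, 1, 5) ∧ psi (chartC ![3, 2, -1] 0 2) = (1, 1, 4) := by decide

/-- [OURS · idea-1 memo §14.4] **The value cycle without TB2.** From `A = (-2, -1, 2)` the NON-TB2 line move `(c, d) = (2, 1)` in its
`d`-chart gives `B = (-2, 1, 2)`, and from `B` the (TB2-compliant) move `(1, 0)` in its `c`-chart gives back `A`. -/
theorem noTB2_cycle :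
    IsLineMove ![-2, -1, 2] 2 1 ∧ ¬ IsTB2Move ![-2, -1, 2] 2 1 ∧ chartD ![-2, -1, 2] 2 1 = ![-2, 1, 2] ∧
      IsTB2Move ![-2, 1, 2] 1 0 ∧ chartC ![-2, 1, 2] 1 0 = ![-2, -1, 2] := by
  decide

end Summit.ResolutionOfSingularities.ResolutionOfSingularities.Theorems.X3Tail
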